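import Summits.AnomalousDissipation.AnomalousDissipation.Theorems.SawtoothPulseCascadeK1LocalisedCascadePhaseOneModes
import Mathlib.Analysis.SpecialFunctions.Integrals.Basic

/-!
# K1loc, line `Spectral` / thin start — helper: SIDEBANDS OF THE EXACT SAWTOOTH CHIRP (S-D start)

Helper file of the prover lane on the crux `K1LocalisedCascade` (stmt-AnomalousDissipation-19491), route `SawtoothPulseCascade`
(S-B/S-C assembly seat; START of the amplitude ledger).  `…PhaseOneModes` reduces the tracked energy of the phase-one inviscid
iterate to energies of the chirps `g_n = e_{−n} ∘ ψ` in shifted tracked sets; this file bounds those for the cascade profile: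
* §1 the EXACT chirp `g₀(t) = exp(−2πiλ·tri(2πt)/(2π))` (`λ ∈ ℤ`, one tooth): on `[−¼,¼]` and `[¼,¾]` it is a character, so
  `ĝ₀(q)` is a sum of two integrals of exponentials: `‖ĝ₀(q)‖ ≤ 1/(π|λ+q|) + 1/(π|λ−q|)` for `q ≠ ±λ`
  (`norm_fourierCoeff_exactChirp_le`), and `ĝ₀(q) = 0` when `λ + q` is even (`fourierCoeff_exactChirp_eq_zero_of_even`);
* §2 hence the LOW-PASS ENERGY `Σ_{|q| ≤ Q} ‖ĝ₀(q)‖² ≤ (2Q+1)·(2|λ|/(π(λ²−Q²)))²` for `Q < |λ|`, halved to `(Q+1)·(…)²` for even `λ`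
  (`sum_sq_norm_fourierCoeff_exactChirp_le`, `…_le_of_even`);
(the rounding perturbation and Bessel live in `…ChirpRounding`).
No definitions (the exact chirp enters through a hypothesis `hg₀ : ∀ t, g₀ t = …`, as in `…SawtoothChirp`); nothing about the crux.
[cite: Grafakos2014, Prop. 3.1.2 (5) and Prop. 3.2.7 (3)] [problem: turb]
-/

-- `Summit.<Summit>.<Problem>`: single-conjunct summit, the duplicate namespace segment is deliberate.
set_option linter.dupNamespace false

noncomputable section

namespace Summit.AnomalousDissipation.AnomalousDissipation.Theorems.SawtoothPulseCascade.K1Start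

open MeasureTheory Set Filter Topology UnitAddTorus Function Complex AddCircle intervalIntegral
open scoped Real
open Literature.Analysis Literature.Analysis.FunctionSpaces Literature.Analysis.FunctionSpaces.Torus Literature.Analysis.FluidPDE
open Literature.Analysis.FluidPDE.SawtoothCascade Literature.Analysis.FluidPDE.SawtoothCascade.CascadeParams

/-! ## §1 The exact chirp: two characters on two arcs -/

/-- An integral of a unimodular exponential over an interval of length `½` with non-zero integer frequency `c` is at most
`1/(π|c|)`: `‖∫_a^{a+½} exp(2πi·c·x + iφ₀) dx‖ ≤ 2/(2π|c|)`. [folklore] -/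
theorem norm_integral_exp_mul_le {c : ℤ} (hc : c ≠ 0) (a b : ℝ) (z : ℂ) (hz : ‖z‖ ≤ 1) :
    ‖∫ x in a..b, z * Complex.exp (2 * π * I * c * x)‖ ≤ 1 / (π * |(c : ℝ)|) := by
  have hC : (2 * π * I * c : ℂ) ≠ 0 := by
    have hπ : (π : ℂ) ≠ 0 := Complex.ofReal_ne_zero.2 Real.pi_pos.ne'
    have hcc : (c : ℂ) ≠ 0 := Int.cast_ne_zero.2 hc
    simp [hπ, hcc, Complex.I_ne_zero]
  rw [intervalIntegral.integral_const_mul, integral_exp_mul_complex hC, norm_mul]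
  have hnum : ‖Complex.exp (2 * π * I * c * b) - Complex.exp (2 * π * I * c * a)‖ ≤ 2 := by
    refine (norm_sub_le _ _).trans ?_
    have h1 : ∀ x : ℝ, ‖Complex.exp (2 * π * I * c * x)‖ = 1 := fun x => by
      rw [show (2 * π * I * c * x : ℂ) = ((2 * π * c * x : ℝ) : ℂ) * I by push_cast; ring, Complex.norm_exp_ofReal_mul_I]
    rw [h1, h1]; norm_num
  have hden : ‖(2 * π * I * c : ℂ)‖ = 2 * π * |(c : ℝ)| := by
    rw [norm_mul, norm_mul, norm_mul, Complex.norm_I, mul_one, Complex.norm_ofNat, Complex.norm_real, Real.norm_eq_abs,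
      abs_of_pos Real.pi_pos, Complex.norm_intCast]
  rw [norm_div, hden]
  have hπc : 0 < π * |(c : ℝ)| := mul_pos Real.pi_pos (abs_pos.2 (Int.cast_ne_zero.2 hc))
  calc ‖z‖ * (‖Complex.exp (2 * π * I * c * b) - Complex.exp (2 * π * I * c * a)‖ / (2 * π * |(c : ℝ)|))
      ≤ 1 * (2 / (2 * π * |(c : ℝ)|)) := by gcongr
    _ = 1 / (π * |(c : ℝ)|) := by field_simp

/-- The same integral VANISHES when the frequency is a non-zero EVEN integer and the interval has length `½`
(`exp(2πi·c·(a+½)) = exp(2πi·c·a)·exp(iπc) = exp(2πi·c·a)`). [folklore] -/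
theorem integral_exp_mul_eq_zero_of_even {c : ℤ} (hc : c ≠ 0) (heven : Even c) (a : ℝ) (z : ℂ) :
    ∫ x in a..(a + 1 / 2), z * Complex.exp (2 * π * I * c * x) = 0 := by
  have hC : (2 * π * I * c : ℂ) ≠ 0 := by
    have hπ : (π : ℂ) ≠ 0 := Complex.ofReal_ne_zero.2 Real.pi_pos.ne'
    have hcc : (c : ℂ) ≠ 0 := Int.cast_ne_zero.2 hc
    simp [hπ, hcc, Complex.I_ne_zero]
  obtain ⟨k, hk⟩ := heven
  rw [intervalIntegral.integral_const_mul, integral_exp_mul_complex hC]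
  have hper : Complex.exp (2 * π * I * c * ((a + 1 / 2 : ℝ) : ℂ)) = Complex.exp (2 * π * I * c * (a : ℂ)) := by
    have hsplit : (2 * π * I * c * ((a + 1 / 2 : ℝ) : ℂ)) = 2 * π * I * c * (a : ℂ) + (k : ℂ) * (2 * π * I) := by
      rw [hk]; push_cast; ring
    rw [hsplit, Complex.exp_add, Complex.exp_int_mul_two_pi_mul_I, mul_one]
  rw [hper, sub_self, zero_div, mul_zero]

/-- **Sidebands of the exact one-tooth chirp.**  Let `λ ∈ ℤ` and let `g₀` be the circle function with
`g₀(t) = exp(−2πiλ·tri(2πt)/(2π))` (`tri = arcsin ∘ sin`; slope `+1` on `[−¼,¼]`, `−1` on `[¼,¾]`).  For `q ≠ ±λ`,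
`‖ĝ₀(q)‖ ≤ 1/(π|λ+q|) + 1/(π|λ−q|)`: on the rising arc the integrand of `ĝ₀(q) = ∫_{−¼}^{¾} e_{−q}g₀` is `exp(−2πi(λ+q)t)`, on the
falling arc `e^{−iπλ}exp(2πi(λ−q)t)`. [cite: Grafakos2014, Prop. 3.1.2 (5)] -/
theorem norm_fourierCoeff_exactChirp_le {lam : ℤ} {g₀ : UnitAddCircle → ℂ}
    (hg₀ : ∀ t : ℝ, g₀ (t : UnitAddCircle) = Complex.exp (-(2 * π * I * lam * ((tri (2 * π * t) / (2 * π) : ℝ) : ℂ))))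
    (hg₀c : Continuous g₀) {q : ℤ} (hq₁ : q ≠ -lam) (hq₂ : q ≠ lam) :
    ‖fourierCoeff g₀ q‖ ≤ 1 / (π * |((lam + q : ℤ) : ℝ)|) + 1 / (π * |((lam - q : ℤ) : ℝ)|) := by
  have hπ : 0 < π := Real.pi_pos
  -- the coefficient as an integral over `[−¼, ¾]`
  have hF : fourierCoeff g₀ q = ∫ x in (-(1 / 4) : ℝ)..(-(1 / 4) + 1), (fourier (-q) (x : UnitAddCircle) : ℂ) * g₀ x := by
    rw [fourierCoeff_eq_intervalIntegral g₀ q (-(1 / 4))]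
    simp
  -- the integrand on the two arcs
  set F : ℝ → ℂ := fun x => (fourier (-q) (x : UnitAddCircle) : ℂ) * g₀ x with hFdef
  have hFc : Continuous F := ((fourier (-q)).continuous.comp continuous_quotient_mk').mul (hg₀c.comp continuous_quotient_mk')
  have hrise : ∀ x ∈ uIcc (-(1 / 4) : ℝ) (1 / 4), F x = 1 * Complex.exp (2 * π * I * ((-(lam + q) : ℤ)) * x) := by
    intro x hx
    rw [uIcc_of_le (by norm_num)] at hx
    have htri : tri (2 * π * x) = 2 * π * x := tri_eq_self (by nlinarith [hx.1]) (by nlinarith [hx.2])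
    simp only [hFdef, hg₀ x, htri, fourier_coe_apply]
    rw [← Complex.exp_add, one_mul]
    congr 1
    push_cast
    field_simp
    ring
  have hfall : ∀ x ∈ uIcc (1 / 4 : ℝ) (3 / 4), F x =
      Complex.exp (-(π * I * lam)) * Complex.exp (2 * π * I * ((lam - q : ℤ)) * x) := by
    intro x hx
    rw [uIcc_of_le (by norm_num)] at hx
    have htri : tri (2 * π * x) = π - 2 * π * x := tri_eq_pi_sub (by nlinarith [hx.1]) (by nlinarith [hx.2])
    simp only [hFdef, hg₀ x, htri, fourier_coe_apply]
    rw [← Complex.exp_add, ← Complex.exp_add]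
    congr 1
    push_cast
    field_simp
    ring
  -- split and bound
  have hsplit : (∫ x in (-(1 / 4) : ℝ)..(-(1 / 4) + 1), F x) =
      (∫ x in (-(1 / 4) : ℝ)..(1 / 4), F x) + ∫ x in (1 / 4 : ℝ)..(3 / 4), F x := by
    rw [show (-(1 / 4) + 1 : ℝ) = 3 / 4 by norm_num]
    exact (integral_add_adjacent_intervals (hFc.intervalIntegrable (μ := volume) _ _) (hFc.intervalIntegrable (μ := volume) _ _)).symm
  have h1 : ‖∫ x in (-(1 / 4) : ℝ)..(1 / 4), F x‖ ≤ 1 / (π * |((lam + q : ℤ) : ℝ)|) := by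
    rw [integral_congr hrise]
    have hc : (-(lam + q) : ℤ) ≠ 0 := by omega
    have h := norm_integral_exp_mul_le hc (-(1 / 4)) (1 / 4) 1 (by simp)
    have e : |((-(lam + q) : ℤ) : ℝ)| = |((lam + q : ℤ) : ℝ)| := by rw [Int.cast_neg, abs_neg]
    rw [e] at h
    exact h
  have h2 : ‖∫ x in (1 / 4 : ℝ)..(3 / 4), F x‖ ≤ 1 / (π * |((lam - q : ℤ) : ℝ)|) := by
    rw [integral_congr hfall]
    have hc : (lam - q : ℤ) ≠ 0 := by omega
    have hz : ‖Complex.exp (-(π * I * lam))‖ ≤ 1 := by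
      rw [show (-(π * I * lam) : ℂ) = ((-(π * lam) : ℝ) : ℂ) * I by push_cast; ring, Complex.norm_exp_ofReal_mul_I]
    exact norm_integral_exp_mul_le hc (1 / 4) (3 / 4) _ hz
  rw [hF, hsplit]
  exact (norm_add_le _ _).trans (add_le_add h1 h2)

/-- **Parity**: for `λ + q` even (then `λ − q` is even too) and `q ≠ ±λ`, `ĝ₀(q) = 0` — both arcs have length `½` and carry a
non-zero even frequency. [cite: Grafakos2014, Prop. 3.1.2 (5)] -/
theorem fourierCoeff_exactChirp_eq_zero_of_even {lam : ℤ} {g₀ : UnitAddCircle → ℂ}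
    (hg₀ : ∀ t : ℝ, g₀ (t : UnitAddCircle) = Complex.exp (-(2 * π * I * lam * ((tri (2 * π * t) / (2 * π) : ℝ) : ℂ))))
    (hg₀c : Continuous g₀) {q : ℤ} (heven : Even (lam + q)) (hq₁ : q ≠ -lam) (hq₂ : q ≠ lam) :
    fourierCoeff g₀ q = 0 := by
  have hπ : 0 < π := Real.pi_pos
  have hF : fourierCoeff g₀ q = ∫ x in (-(1 / 4) : ℝ)..(-(1 / 4) + 1), (fourier (-q) (x : UnitAddCircle) : ℂ) * g₀ x := by
    rw [fourierCoeff_eq_intervalIntegral g₀ q (-(1 / 4))]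
    simp
  set F : ℝ → ℂ := fun x => (fourier (-q) (x : UnitAddCircle) : ℂ) * g₀ x with hFdef
  have hFc : Continuous F := ((fourier (-q)).continuous.comp continuous_quotient_mk').mul (hg₀c.comp continuous_quotient_mk')
  have hrise : ∀ x ∈ uIcc (-(1 / 4) : ℝ) (-(1 / 4) + 1 / 2), F x = 1 * Complex.exp (2 * π * I * ((-(lam + q) : ℤ)) * x) := by
    intro x hx
    rw [uIcc_of_le (by norm_num)] at hx
    have htri : tri (2 * π * x) = 2 * π * x := tri_eq_self (by nlinarith [hx.1]) (by nlinarith [hx.2])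
    simp only [hFdef, hg₀ x, htri, fourier_coe_apply]
    rw [← Complex.exp_add, one_mul]
    congr 1
    push_cast
    field_simp
    ring
  have hfall : ∀ x ∈ uIcc (1 / 4 : ℝ) (1 / 4 + 1 / 2), F x =
      Complex.exp (-(π * I * lam)) * Complex.exp (2 * π * I * ((lam - q : ℤ)) * x) := by
    intro x hx
    rw [uIcc_of_le (by norm_num)] at hx
    have htri : tri (2 * π * x) = π - 2 * π * x := tri_eq_pi_sub (by nlinarith [hx.1]) (by nlinarith [hx.2])
    simp only [hFdef, hg₀ x, htri, fourier_coe_apply]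
    rw [← Complex.exp_add, ← Complex.exp_add]
    congr 1
    push_cast
    field_simp
    ring
  have hsplit : (∫ x in (-(1 / 4) : ℝ)..(-(1 / 4) + 1), F x) =
      (∫ x in (-(1 / 4) : ℝ)..(-(1 / 4) + 1 / 2), F x) + ∫ x in (1 / 4 : ℝ)..(1 / 4 + 1 / 2), F x := by
    rw [show (-(1 / 4) + 1 : ℝ) = 1 / 4 + 1 / 2 by norm_num]
    have h := (integral_add_adjacent_intervals (a := (-(1 / 4) : ℝ)) (b := -(1 / 4) + 1 / 2) (c := 1 / 4 + 1 / 2)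
      (hFc.intervalIntegrable (μ := volume) _ _) (hFc.intervalIntegrable (μ := volume) _ _)).symm
    rw [show (-(1 / 4) + 1 / 2 : ℝ) = 1 / 4 by norm_num] at h ⊢
    exact h
  have heven' : Even (lam - q) := by
    obtain ⟨k, hk⟩ := heven; exact ⟨k - q, by omega⟩
  have h1 : ∫ x in (-(1 / 4) : ℝ)..(-(1 / 4) + 1 / 2), F x = 0 := by
    rw [integral_congr hrise]
    exact integral_exp_mul_eq_zero_of_even (by omega) (Even.neg heven) _ _
  have h2 : ∫ x in (1 / 4 : ℝ)..(1 / 4 + 1 / 2), F x = 0 := by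
    rw [integral_congr hfall]
    exact integral_exp_mul_eq_zero_of_even (by omega) heven' _ _
  rw [hF, hsplit, h1, h2, add_zero]

/-! ## §2 Low-pass energy of the exact chirp -/

/-- For `|q| ≤ Q < |λ|`: `1/|λ+q| + 1/|λ−q| = 2|λ|/(λ² − q²) ≤ 2|λ|/(λ² − Q²)`. [folklore] -/
theorem inv_add_inv_le_of_abs_le {lam q : ℤ} {Q : ℕ} (hq : |q| ≤ Q) (hQ : (Q : ℤ) < |lam|) :
    1 / (π * |((lam + q : ℤ) : ℝ)|) + 1 / (π * |((lam - q : ℤ) : ℝ)|) ≤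
      2 * |(lam : ℝ)| / (π * ((lam : ℝ) ^ 2 - (Q : ℝ) ^ 2)) := by
  have hπ : 0 < π := Real.pi_pos
  have hqQ : |(q : ℝ)| ≤ (Q : ℝ) := by exact_mod_cast hq
  have hQl : (Q : ℝ) < |(lam : ℝ)| := by exact_mod_cast hQ
  have hQ0 : (0 : ℝ) ≤ Q := Nat.cast_nonneg Q
  have hq' : |(q : ℝ)| < |(lam : ℝ)| := lt_of_le_of_lt hqQ hQl
  -- `|λ ± q| ≥ |λ| − |q| > 0`
  have hp : 0 < |(lam : ℝ)| - |(q : ℝ)| := by linarith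
  have h1 : |(lam : ℝ)| - |(q : ℝ)| ≤ |((lam + q : ℤ) : ℝ)| := by
    push_cast; have := abs_sub_abs_le_abs_add (lam : ℝ) q
    -- `|λ| - |q| ≤ |λ + q|`
    linarith [abs_add_le ((lam : ℝ) + q) (-q), abs_neg (q : ℝ)]
  have h2 : |(lam : ℝ)| - |(q : ℝ)| ≤ |((lam - q : ℤ) : ℝ)| := by
    push_cast; exact abs_sub_abs_le_abs_sub _ _
  -- the exact identity `|λ+q|·|λ−q| = λ² − q²` and monotonicity in `|q|`
  have hprod : |((lam + q : ℤ) : ℝ)| * |((lam - q : ℤ) : ℝ)| = (lam : ℝ) ^ 2 - (q : ℝ) ^ 2 := by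
    push_cast
    rw [← abs_mul, show ((lam : ℝ) + q) * (lam - q) = (lam : ℝ) ^ 2 - (q : ℝ) ^ 2 by ring]
    exact abs_of_pos (by nlinarith [sq_abs (q : ℝ), sq_abs (lam : ℝ), abs_nonneg (q : ℝ)])
  have hsum : |((lam + q : ℤ) : ℝ)| + |((lam - q : ℤ) : ℝ)| = 2 * |(lam : ℝ)| := by
    -- both `λ+q` and `λ−q` have the sign of `λ`
    push_cast
    rcases le_or_gt 0 (lam : ℝ) with hl | hl
    · rw [abs_of_nonneg hl] at hq'
      rw [abs_of_nonneg hl, abs_of_pos (by linarith [abs_lt.1 hq']), abs_of_pos (by linarith [abs_lt.1 hq'])]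
      ring
    · rw [abs_of_neg hl] at hq'
      rw [abs_of_neg hl, abs_of_neg (by linarith [abs_lt.1 hq']), abs_of_neg (by linarith [abs_lt.1 hq'])]
      ring
  have hA : 0 < |((lam + q : ℤ) : ℝ)| := lt_of_lt_of_le hp h1
  have hB : 0 < |((lam - q : ℤ) : ℝ)| := lt_of_lt_of_le hp h2
  have hD : 0 < (lam : ℝ) ^ 2 - (Q : ℝ) ^ 2 := by nlinarith [abs_nonneg (lam : ℝ), sq_abs (lam : ℝ)]
  rw [div_add_div _ _ (by positivity) (by positivity), div_le_div_iff₀ (by positivity) (by positivity)]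
  have hq2 : (q : ℝ) ^ 2 ≤ (Q : ℝ) ^ 2 := by nlinarith [sq_abs (q : ℝ), abs_nonneg (q : ℝ)]
  calc (1 * (π * |((lam - q : ℤ) : ℝ)|) + π * |((lam + q : ℤ) : ℝ)| * 1) * (π * ((lam : ℝ) ^ 2 - (Q : ℝ) ^ 2))
      = π ^ 2 * (2 * |(lam : ℝ)|) * ((lam : ℝ) ^ 2 - (Q : ℝ) ^ 2) := by rw [← hsum]; ring
    _ ≤ π ^ 2 * (2 * |(lam : ℝ)|) * ((lam : ℝ) ^ 2 - (q : ℝ) ^ 2) := by gcongr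
    _ = 2 * |(lam : ℝ)| * (π * |((lam + q : ℤ) : ℝ)| * (π * |((lam - q : ℤ) : ℝ)|)) := by
        rw [show π * |((lam + q : ℤ) : ℝ)| * (π * |((lam - q : ℤ) : ℝ)|) =
          π ^ 2 * (|((lam + q : ℤ) : ℝ)| * |((lam - q : ℤ) : ℝ)|) by ring, hprod]; ring

/-- **Low-pass energy of the exact chirp**: for `Q < |λ|`,
`Σ_{q=−Q}^{Q} ‖ĝ₀(q)‖² ≤ (2Q+1)·(2|λ|/(π(λ²−Q²)))²`. [cite: Grafakos2014, Prop. 3.1.2 (5)] -/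
theorem sum_sq_norm_fourierCoeff_exactChirp_le {lam : ℤ} {g₀ : UnitAddCircle → ℂ}
    (hg₀ : ∀ t : ℝ, g₀ (t : UnitAddCircle) = Complex.exp (-(2 * π * I * lam * ((tri (2 * π * t) / (2 * π) : ℝ) : ℂ))))
    (hg₀c : Continuous g₀) {Q : ℕ} (hQ : (Q : ℤ) < |lam|) :
    ∑ q ∈ Finset.Icc (-(Q : ℤ)) Q, ‖fourierCoeff g₀ q‖ ^ 2 ≤
      (2 * Q + 1) * (2 * |(lam : ℝ)| / (π * ((lam : ℝ) ^ 2 - (Q : ℝ) ^ 2))) ^ 2 := by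
  have hterm : ∀ q ∈ Finset.Icc (-(Q : ℤ)) Q, ‖fourierCoeff g₀ q‖ ^ 2 ≤
      (2 * |(lam : ℝ)| / (π * ((lam : ℝ) ^ 2 - (Q : ℝ) ^ 2))) ^ 2 := by
    intro q hq
    rw [Finset.mem_Icc] at hq
    have hqa : |q| ≤ Q := abs_le.2 ⟨hq.1, hq.2⟩
    have hq1 : q ≠ -lam := by intro h; rw [h, abs_neg] at hqa; omega
    have hq2 : q ≠ lam := by intro h; rw [h] at hqa; omega
    have h0 : 0 ≤ ‖fourierCoeff g₀ q‖ := norm_nonneg _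
    exact pow_le_pow_left₀ h0 ((norm_fourierCoeff_exactChirp_le hg₀ hg₀c hq1 hq2).trans
      (inv_add_inv_le_of_abs_le hqa hQ)) 2
  refine (Finset.sum_le_sum hterm).trans ?_
  rw [Finset.sum_const, nsmul_eq_mul]
  have hcard : ((Finset.Icc (-(Q : ℤ)) Q).card : ℝ) = 2 * Q + 1 := by
    rw [Int.card_Icc]
    have h : ((Q : ℤ) + 1 - -(Q : ℤ)).toNat = 2 * Q + 1 := by omega
    rw [h]; push_cast; ring
  rw [hcard]

/-- **Low-pass energy of the exact chirp, even `λ`**: only odd `q` contribute, so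
`Σ_{q=−Q}^{Q} ‖ĝ₀(q)‖² ≤ (Q+1)·(2|λ|/(π(λ²−Q²)))²` for `Q < |λ|`. [cite: Grafakos2014, Prop. 3.1.2 (5)] -/
theorem sum_sq_norm_fourierCoeff_exactChirp_le_of_even {lam : ℤ} (hlam : Even lam) {g₀ : UnitAddCircle → ℂ}
    (hg₀ : ∀ t : ℝ, g₀ (t : UnitAddCircle) = Complex.exp (-(2 * π * I * lam * ((tri (2 * π * t) / (2 * π) : ℝ) : ℂ))))
    (hg₀c : Continuous g₀) {Q : ℕ} (hQ : (Q : ℤ) < |lam|) :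
    ∑ q ∈ Finset.Icc (-(Q : ℤ)) Q, ‖fourierCoeff g₀ q‖ ^ 2 ≤
      (Q + 1) * (2 * |(lam : ℝ)| / (π * ((lam : ℝ) ^ 2 - (Q : ℝ) ^ 2))) ^ 2 := by
  classical
  set B : ℝ := (2 * |(lam : ℝ)| / (π * ((lam : ℝ) ^ 2 - (Q : ℝ) ^ 2))) ^ 2 with hB
  have hB0 : 0 ≤ B := sq_nonneg _
  -- even `q` contribute nothing
  have hterm : ∀ q ∈ Finset.Icc (-(Q : ℤ)) Q, ‖fourierCoeff g₀ q‖ ^ 2 ≤ if Odd q then B else 0 := by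
    intro q hq
    rw [Finset.mem_Icc] at hq
    have hqa : |q| ≤ Q := abs_le.2 ⟨hq.1, hq.2⟩
    have hq1 : q ≠ -lam := by intro h; rw [h, abs_neg] at hqa; omega
    have hq2 : q ≠ lam := by intro h; rw [h] at hqa; omega
    split_ifs with hodd
    · exact pow_le_pow_left₀ (norm_nonneg _) ((norm_fourierCoeff_exactChirp_le hg₀ hg₀c hq1 hq2).trans
        (inv_add_inv_le_of_abs_le hqa hQ)) 2
    · have hev : Even (lam + q) := hlam.add (Int.not_odd_iff_even.1 hodd)
      rw [fourierCoeff_exactChirp_eq_zero_of_even hg₀ hg₀c hev hq1 hq2]; simp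
  refine (Finset.sum_le_sum hterm).trans ?_
  rw [Finset.sum_ite, Finset.sum_const_zero, add_zero, Finset.sum_const, nsmul_eq_mul]
  refine mul_le_mul_of_nonneg_right ?_ hB0
  -- at most `Q + 1` odd integers in `[−Q, Q]`: they inject into `[0, Q]` under `q ↦ (q + Q) / 2`
  have hcard : ((Finset.Icc (-(Q : ℤ)) Q).filter Odd).card ≤ Q + 1 := by
    have hinj : Set.InjOn (fun q : ℤ => (q + Q) / 2) ↑((Finset.Icc (-(Q : ℤ)) Q).filter Odd) := by
      intro x hx y hy hxy
      simp only [Finset.coe_filter, Finset.mem_Icc, Set.mem_setOf_eq] at hx hy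
      obtain ⟨a, ha⟩ := hx.2; obtain ⟨b, hb⟩ := hy.2
      simp only at hxy
      omega
    have hmaps : ∀ q ∈ (Finset.Icc (-(Q : ℤ)) Q).filter Odd, (fun q : ℤ => (q + Q) / 2) q ∈ Finset.Icc (0 : ℤ) Q := by
      intro q hq
      simp only [Finset.mem_filter, Finset.mem_Icc] at hq ⊢
      omega
    have h := Finset.card_le_card_of_injOn _ hmaps hinj
    rw [Int.card_Icc] at h
    have : ((Q : ℤ) + 1 - 0).toNat = Q + 1 := by omega
    omega
  exact_mod_cast hcard

end Summit.AnomalousDissipation.AnomalousDissipation.Theorems.SawtoothPulseCascade.K1Start
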